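import Literature.Topology.FourManifolds.CappellShanesonClassGroupThirtyone
import Literature.Topology.FourManifolds.CappellShanesonClassGroupThirtyoneCls
import Literature.Topology.FourManifolds.CappellShanesonTotallyReal
import Literature.Topology.FourManifolds.CappellShanesonClassGroupTwelve
import Literature.Topology.FourManifolds.CappellShanesonClassGroupFifteen
import HarnessLib

/-!
# Trace `31`: the class group, the cover of `C(ℤ[Θ₃₁])`, Gompf's conjecture for the traces `31` and `-26`

Part 'Main' of the certified class-group computation for the trace `31` field behind
Kim–Yamada's Theorem B (`GompfConjectureForTrace 31` and, by Theorem A, `-26`), serving the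
named fact
`Literature.Topology.FourManifolds.kimYamada2023_nonempty_diffeomorph_sphere_four_of_trace_mem_Icc`
(`CappellShaneson.lean`; M. H. Kim, S. Yamada, Kyungpook Math. J. 63 (2023) 373–411 =
arXiv:1707.03860, Cor. C). The computation is split over several files only because of the
proposal size limit: `…ClassGroupThirtyone.lean` (discriminant, `𝓞 K = ℤ[θ]`, the primes of small norm), `…ClassGroupThirtyoneRel<k>.lean` (two-ideal relations with certified generators and the non-vanishing of the generators), `…ClassGroupThirtyoneCls.lean` (the class of every small prime in terms of the generator(s), the order relations), `…ClassGroupThirtyoneMain.lean` (generation of the class group by Minkowski's bound, the cover of `C(ℤ[Θ])` by standard-matrix representatives, Gompf's conjecture for the two traces). (File generated from a certified computation; every relation is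
checked by the Lean kernel; no named fact is introduced, D-0026.)

## References

* [KimYamada2023] M. H. Kim, S. Yamada, Kyungpook Math. J. 63 (2023) 373–411 (arXiv:1707.03860):
  §2.3 (Prop. 2.14), §6.1 (Lemma 6.1 and the proof of Thm. B), Thm. A.
* [Marcus2018] D. A. Marcus, *Number Fields*, 2nd ed., Ch. 3, Thm. 27 (Dedekind–Kummer); Ch. 5,
  Cor. 2 of Thm. 37 (Minkowski bound) and the class-group computations after it.
-/

noncomputable section

open Set Polynomial Module NumberField Ideal
open scoped NumberField MatrixGroups nonZeroDivisors
open Literature.LinearAlgebra.Matrix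

namespace Literature.Topology.FourManifolds

section Field

variable {K : Type*} [Field K] [NumberField K] {θ : K}

set_option maxHeartbeats 2000000 in
/-- **Every ideal class of the trace `31` field is a power `aʳ`, `0 ≤ r < 7`, of `a = [(3, θ - 2)]`,
represented by the ideals listed** (so the class number divides `7`). Proof: `d_K = 654449`,
`⌊M_K⌋ ≤ 179`, Dedekind–Kummer at `p ≤ 179`, and the class of every small prime computed above
from two-ideal relations with certified generators. [cite: KimYamada2023, §6.1 (proof of Thm. B)] -/
theorem classGroup_mem_thirtyone (hθ : aeval θ (csPoly 31) = 0) (h3 : finrank ℚ K = 3)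
    (C : ClassGroup (𝓞 K)) :
    C = 1 ∨
      C = ClassGroup.mk0 ⟨span {(3 : 𝓞 K), thetaInt hθ - 2}, (span_pair_ofNat_mem_nonZeroDivisors (nat_lit 3) (thetaInt hθ - 2))⟩ ∨
      C = ClassGroup.mk0 ⟨span {(41 : 𝓞 K), thetaInt hθ - 11}, (span_pair_ofNat_mem_nonZeroDivisors (nat_lit 41) (thetaInt hθ - 11))⟩ ∨
      C = ClassGroup.mk0 ⟨span {(23 : 𝓞 K), thetaInt hθ - 15}, (span_pair_ofNat_mem_nonZeroDivisors (nat_lit 23) (thetaInt hθ - 15))⟩ ∨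
      C = ClassGroup.mk0 ⟨span {(17 : 𝓞 K), thetaInt hθ - 11}, (span_pair_ofNat_mem_nonZeroDivisors (nat_lit 17) (thetaInt hθ - 11))⟩ ∨
      C = ClassGroup.mk0 ⟨span {(7 : 𝓞 K), thetaInt hθ - 6}, (span_pair_ofNat_mem_nonZeroDivisors (nat_lit 7) (thetaInt hθ - 6))⟩ ∨
      C = ClassGroup.mk0 ⟨span {(17 : 𝓞 K), thetaInt hθ - 9}, (span_pair_ofNat_mem_nonZeroDivisors (nat_lit 17) (thetaInt hθ - 9))⟩ := by
  classical
  obtain ⟨a, ha⟩ : ∃ a : ClassGroup (𝓞 K), ClassGroup.mk0 ⟨span {(3 : 𝓞 K), thetaInt hθ - 2}, (span_pair_ofNat_mem_nonZeroDivisors (nat_lit 3) (thetaInt hθ - 2))⟩ = a := ⟨_, rfl⟩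
  have ham : a ^ (7 : ℤ) = 1 := by rw [← ha]; exact pow_order_thirtyone hθ
  let H : Subgroup (ClassGroup (𝓞 K)) := Subgroup.zpowers a
  have hprinc : ∀ (P : Ideal (𝓞 K)) (hP0 : P ∈ (Ideal (𝓞 K))⁰) (x : 𝓞 K), P = span {x} →
      ClassGroup.mk0 ⟨P, hP0⟩ ∈ H := by
    intro P hP0 x hPx
    have : ClassGroup.mk0 ⟨P, hP0⟩ = 1 :=
      (ClassGroup.mk0_eq_one_iff hP0).mpr ⟨⟨x, by rw [hPx, submodule_span_eq]⟩⟩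
    rw [this]
    exact H.one_mem
  -- Minkowski: `⌊M_K⌋ ≤ 179`
  have hd : ((|NumberField.discr K| : ℤ) : ℝ) ≤ (654449 : ℕ) := by
    rw [discr_eq_thirtyone hθ h3]
    norm_num
  have hfloor := floor_minkowskiBound_le_cubic_real h3 (nrComplexPlaces_eq_zero_of_csPoly hθ h3 (by norm_num))
    hd (s := 809) (U := 179) (by norm_num) (by norm_num) (by norm_num)
  have htop : H = ⊤ := by
    refine classGroup_subgroup_eq_top_of_primesOver H hfloor fun p hp hprime P hP0 hP hle => ?_
    have hpU : p ≤ 179 := (Finset.mem_Icc.mp hp).2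
    have h1p : 1 ≤ p := (Finset.mem_Icc.mp hp).1
    interval_cases p
    · exact absurd hprime (by norm_num)
    · exact hprinc P hP0 _ (eq_span_of_inert_thirtyone hθ h3 (by norm_num) hP)
    · -- `p = 3`
      rcases eq_P3_or_eq_Q3_thirtyone hθ h3 hP with h | h <;> subst h
      · rw [show ClassGroup.mk0 ⟨_, hP0⟩ = ClassGroup.mk0 ⟨span {(3 : 𝓞 K), thetaInt hθ - 2}, (span_pair_ofNat_mem_nonZeroDivisors (nat_lit 3) (thetaInt hθ - 2))⟩ from rfl, ha]
        exact Subgroup.mem_zpowers a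
      · exact mem_zpowers_of_mk0_eq a (cls_Q3_thirtyone hθ) ha
    · exact absurd hprime (by norm_num)
    · exact hprinc P hP0 _ (eq_span_of_inert_thirtyone hθ h3 (by norm_num) hP)
    · exact absurd hprime (by norm_num)
    · -- `p = 7`
      rcases eq_P7_or_eq_Q7_thirtyone hθ h3 hP with h | h <;> subst h
      · exact mem_zpowers_of_mk0_eq a (cls_P7_6_thirtyone hθ) ha
      · exact mem_zpowers_of_mk0_eq a (cls_Q7_thirtyone hθ) ha
    · exact absurd hprime (by norm_num)
    · exact absurd hprime (by norm_num)
    · exact absurd hprime (by norm_num)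
    · exact hprinc P hP0 _ (eq_span_of_inert_thirtyone hθ h3 (by norm_num) hP)
    · exact absurd hprime (by norm_num)
    · exact hprinc P hP0 _ (eq_span_of_inert_thirtyone hθ h3 (by norm_num) hP)
    · exact absurd hprime (by norm_num)
    · exact absurd hprime (by norm_num)
    · exact absurd hprime (by norm_num)
    · -- `p = 17` (ramified)
      rcases eq_P17_thirtyone hθ h3 hP with h | h | h <;> subst h
      · exact mem_zpowers_of_mk0_eq a (cls_P17_9_thirtyone hθ) ha
      · exact mem_zpowers_of_mk0_eq a (cls_P17_11_thirtyone hθ) ha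
      · exact mem_zpowers_of_mk0_eq a (cls_P17_11_thirtyone hθ) ha
    · exact absurd hprime (by norm_num)
    · -- `p = 19`
      have h := eq_span_pair_of_unique_root_thirtyone hθ h3 (Or.inl ⟨rfl, rfl⟩) hP hle
      simp only [Nat.cast_ofNat, Int.cast_ofNat] at h
      subst h
      exact mem_zpowers_of_mk0_eq a (cls_P19_2_thirtyone hθ) ha
    · exact absurd hprime (by norm_num)
    · exact absurd hprime (by norm_num)
    · exact absurd hprime (by norm_num)
    · -- `p = 23`
      have h := eq_span_pair_of_unique_root_thirtyone hθ h3 (Or.inr (Or.inl ⟨rfl, rfl⟩)) hP hle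
      simp only [Nat.cast_ofNat, Int.cast_ofNat] at h
      subst h
      exact mem_zpowers_of_mk0_eq a (cls_P23_15_thirtyone hθ) ha
    · exact absurd hprime (by norm_num)
    · exact absurd hprime (by norm_num)
    · exact absurd hprime (by norm_num)
    · exact absurd hprime (by norm_num)
    · exact absurd hprime (by norm_num)
    · exact hprinc P hP0 _ (eq_span_of_inert_thirtyone hθ h3 (by norm_num) hP)
    · exact absurd hprime (by norm_num)
    · exact hprinc P hP0 _ (eq_span_of_inert_thirtyone hθ h3 (by norm_num) hP)
    · exact absurd hprime (by norm_num)
    · exact absurd hprime (by norm_num)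
    · exact absurd hprime (by norm_num)
    · exact absurd hprime (by norm_num)
    · exact absurd hprime (by norm_num)
    · exact hprinc P hP0 _ (eq_span_of_inert_thirtyone hθ h3 (by norm_num) hP)
    · exact absurd hprime (by norm_num)
    · exact absurd hprime (by norm_num)
    · exact absurd hprime (by norm_num)
    · -- `p = 41`
      have h := eq_span_pair_of_unique_root_thirtyone hθ h3 (Or.inr (Or.inr (Or.inl ⟨rfl, rfl⟩))) hP hle
      simp only [Nat.cast_ofNat, Int.cast_ofNat] at h
      subst h
      exact mem_zpowers_of_mk0_eq a (cls_P41_11_thirtyone hθ) ha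
    · exact absurd hprime (by norm_num)
    · -- `p = 43`
      have h := eq_span_pair_of_unique_root_thirtyone hθ h3 (Or.inr (Or.inr (Or.inr (Or.inl ⟨rfl, rfl⟩)))) hP hle
      simp only [Nat.cast_ofNat, Int.cast_ofNat] at h
      subst h
      exact mem_zpowers_of_mk0_eq a (cls_P43_27_thirtyone hθ) ha
    · exact absurd hprime (by norm_num)
    · exact absurd hprime (by norm_num)
    · exact absurd hprime (by norm_num)
    · exact hprinc P hP0 _ (eq_span_of_inert_thirtyone hθ h3 (by norm_num) hP)
    · exact absurd hprime (by norm_num)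
    · exact absurd hprime (by norm_num)
    · exact absurd hprime (by norm_num)
    · exact absurd hprime (by norm_num)
    · exact absurd hprime (by norm_num)
    · -- `p = 53`
      have h := eq_span_pair_of_unique_root_thirtyone hθ h3 (Or.inr (Or.inr (Or.inr (Or.inr (Or.inl ⟨rfl, rfl⟩))))) hP hle
      simp only [Nat.cast_ofNat, Int.cast_ofNat] at h
      subst h
      exact mem_zpowers_of_mk0_eq a (cls_P53_19_thirtyone hθ) ha
    · exact absurd hprime (by norm_num)
    · exact absurd hprime (by norm_num)
    · exact absurd hprime (by norm_num)
    · exact absurd hprime (by norm_num)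
    · exact absurd hprime (by norm_num)
    · exact hprinc P hP0 _ (eq_span_of_inert_thirtyone hθ h3 (by norm_num) hP)
    · exact absurd hprime (by norm_num)
    · exact hprinc P hP0 _ (eq_span_of_inert_thirtyone hθ h3 (by norm_num) hP)
    · exact absurd hprime (by norm_num)
    · exact absurd hprime (by norm_num)
    · exact absurd hprime (by norm_num)
    · exact absurd hprime (by norm_num)
    · exact absurd hprime (by norm_num)
    · exact hprinc P hP0 _ (eq_span_of_inert_thirtyone hθ h3 (by norm_num) hP)
    · exact absurd hprime (by norm_num)
    · exact absurd hprime (by norm_num)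
    · exact absurd hprime (by norm_num)
    · -- `p = 71`
      have h := eq_span_pair_of_unique_root_thirtyone hθ h3 (Or.inr (Or.inr (Or.inr (Or.inr (Or.inr (Or.inl ⟨rfl, rfl⟩)))))) hP hle
      simp only [Nat.cast_ofNat, Int.cast_ofNat] at h
      subst h
      exact mem_zpowers_of_mk0_eq a (cls_P71_19_thirtyone hθ) ha
    · exact absurd hprime (by norm_num)
    · exact hprinc P hP0 _ (eq_span_of_inert_thirtyone hθ h3 (by norm_num) hP)
    · exact absurd hprime (by norm_num)
    · exact absurd hprime (by norm_num)
    · exact absurd hprime (by norm_num)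
    · exact absurd hprime (by norm_num)
    · exact absurd hprime (by norm_num)
    · exact hprinc P hP0 _ (eq_span_of_inert_thirtyone hθ h3 (by norm_num) hP)
    · exact absurd hprime (by norm_num)
    · exact absurd hprime (by norm_num)
    · exact absurd hprime (by norm_num)
    · exact hprinc P hP0 _ (eq_span_of_inert_thirtyone hθ h3 (by norm_num) hP)
    · exact absurd hprime (by norm_num)
    · exact absurd hprime (by norm_num)
    · exact absurd hprime (by norm_num)
    · exact absurd hprime (by norm_num)
    · exact absurd hprime (by norm_num)
    · -- `p = 89` (splits)
      rcases eq_P89_thirtyone hθ h3 hP with h | h | h <;> subst h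
      · exact mem_zpowers_of_mk0_eq a (cls_P89_9_thirtyone hθ) ha
      · exact mem_zpowers_of_mk0_eq a (cls_P89_28_thirtyone hθ) ha
      · exact mem_zpowers_of_mk0_eq a (cls_P89_83_thirtyone hθ) ha
    · exact absurd hprime (by norm_num)
    · exact absurd hprime (by norm_num)
    · exact absurd hprime (by norm_num)
    · exact absurd hprime (by norm_num)
    · exact absurd hprime (by norm_num)
    · exact absurd hprime (by norm_num)
    · exact absurd hprime (by norm_num)
    · -- `p = 97`
      have h := eq_span_pair_of_unique_root_thirtyone hθ h3 (Or.inr (Or.inr (Or.inr (Or.inr (Or.inr (Or.inr (Or.inl ⟨rfl, rfl⟩))))))) hP hle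
      simp only [Nat.cast_ofNat, Int.cast_ofNat] at h
      subst h
      exact mem_zpowers_of_mk0_eq a (cls_P97_81_thirtyone hθ) ha
    · exact absurd hprime (by norm_num)
    · exact absurd hprime (by norm_num)
    · exact absurd hprime (by norm_num)
    · exact hprinc P hP0 _ (eq_span_of_inert_thirtyone hθ h3 (by norm_num) hP)
    · exact absurd hprime (by norm_num)
    · -- `p = 103`
      have h := eq_span_pair_of_unique_root_thirtyone hθ h3 (Or.inr (Or.inr (Or.inr (Or.inr (Or.inr (Or.inr (Or.inr (Or.inl ⟨rfl, rfl⟩)))))))) hP hle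
      simp only [Nat.cast_ofNat, Int.cast_ofNat] at h
      subst h
      exact mem_zpowers_of_mk0_eq a (cls_P103_6_thirtyone hθ) ha
    · exact absurd hprime (by norm_num)
    · exact absurd hprime (by norm_num)
    · exact absurd hprime (by norm_num)
    · exact hprinc P hP0 _ (eq_span_of_inert_thirtyone hθ h3 (by norm_num) hP)
    · exact absurd hprime (by norm_num)
    · -- `p = 109`
      have h := eq_span_pair_of_unique_root_thirtyone hθ h3 (Or.inr (Or.inr (Or.inr (Or.inr (Or.inr (Or.inr (Or.inr (Or.inr (Or.inl ⟨rfl, rfl⟩))))))))) hP hle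
      simp only [Nat.cast_ofNat, Int.cast_ofNat] at h
      subst h
      exact mem_zpowers_of_mk0_eq a (cls_P109_44_thirtyone hθ) ha
    · exact absurd hprime (by norm_num)
    · exact absurd hprime (by norm_num)
    · exact absurd hprime (by norm_num)
    · -- `p = 113`
      have h := eq_span_pair_of_unique_root_thirtyone hθ h3 (Or.inr (Or.inr (Or.inr (Or.inr (Or.inr (Or.inr (Or.inr (Or.inr (Or.inr (Or.inl ⟨rfl, rfl⟩)))))))))) hP hle
      simp only [Nat.cast_ofNat, Int.cast_ofNat] at h
      subst h
      exact mem_zpowers_of_mk0_eq a (cls_P113_62_thirtyone hθ) ha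
    · exact absurd hprime (by norm_num)
    · exact absurd hprime (by norm_num)
    · exact absurd hprime (by norm_num)
    · exact absurd hprime (by norm_num)
    · exact absurd hprime (by norm_num)
    · exact absurd hprime (by norm_num)
    · exact absurd hprime (by norm_num)
    · exact absurd hprime (by norm_num)
    · exact absurd hprime (by norm_num)
    · exact absurd hprime (by norm_num)
    · exact absurd hprime (by norm_num)
    · exact absurd hprime (by norm_num)
    · exact absurd hprime (by norm_num)
    · exact hprinc P hP0 _ (eq_span_of_inert_thirtyone hθ h3 (by norm_num) hP)
    · exact absurd hprime (by norm_num)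
    · exact absurd hprime (by norm_num)
    · exact absurd hprime (by norm_num)
    · -- `p = 131`
      have h := eq_span_pair_of_unique_root_thirtyone hθ h3 (Or.inr (Or.inr (Or.inr (Or.inr (Or.inr (Or.inr (Or.inr (Or.inr (Or.inr (Or.inr (Or.inl ⟨rfl, rfl⟩))))))))))) hP hle
      simp only [Nat.cast_ofNat, Int.cast_ofNat] at h
      subst h
      exact mem_zpowers_of_mk0_eq a (cls_P131_17_thirtyone hθ) ha
    · exact absurd hprime (by norm_num)
    · exact absurd hprime (by norm_num)
    · exact absurd hprime (by norm_num)
    · exact absurd hprime (by norm_num)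
    · exact absurd hprime (by norm_num)
    · -- `p = 137` (ramified)
      rcases eq_P137_thirtyone hθ h3 hP with h | h | h <;> subst h
      · exact mem_zpowers_of_mk0_eq a (cls_P137_8_thirtyone hθ) ha
      · exact mem_zpowers_of_mk0_eq a (cls_P137_8_thirtyone hθ) ha
      · exact mem_zpowers_of_mk0_eq a (cls_P137_15_thirtyone hθ) ha
    · exact absurd hprime (by norm_num)
    · exact hprinc P hP0 _ (eq_span_of_inert_thirtyone hθ h3 (by norm_num) hP)
    · exact absurd hprime (by norm_num)
    · exact absurd hprime (by norm_num)
    · exact absurd hprime (by norm_num)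
    · exact absurd hprime (by norm_num)
    · exact absurd hprime (by norm_num)
    · exact absurd hprime (by norm_num)
    · exact absurd hprime (by norm_num)
    · exact absurd hprime (by norm_num)
    · exact absurd hprime (by norm_num)
    · -- `p = 149`
      have h := eq_span_pair_of_unique_root_thirtyone hθ h3 (Or.inr (Or.inr (Or.inr (Or.inr (Or.inr (Or.inr (Or.inr (Or.inr (Or.inr (Or.inr (Or.inr (Or.inl ⟨rfl, rfl⟩)))))))))))) hP hle
      simp only [Nat.cast_ofNat, Int.cast_ofNat] at h
      subst h
      exact hprinc _ hP0 _ (P149_100_eq_thirtyone hθ)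
    · exact absurd hprime (by norm_num)
    · -- `p = 151`
      have h := eq_span_pair_of_unique_root_thirtyone hθ h3 (Or.inr (Or.inr (Or.inr (Or.inr (Or.inr (Or.inr (Or.inr (Or.inr (Or.inr (Or.inr (Or.inr (Or.inr (Or.inl ⟨rfl, rfl⟩))))))))))))) hP hle
      simp only [Nat.cast_ofNat, Int.cast_ofNat] at h
      subst h
      exact hprinc _ hP0 _ (P151_101_eq_thirtyone hθ)
    · exact absurd hprime (by norm_num)
    · exact absurd hprime (by norm_num)
    · exact absurd hprime (by norm_num)
    · exact absurd hprime (by norm_num)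
    · exact absurd hprime (by norm_num)
    · -- `p = 157`
      have h := eq_span_pair_of_unique_root_thirtyone hθ h3 (Or.inr (Or.inr (Or.inr (Or.inr (Or.inr (Or.inr (Or.inr (Or.inr (Or.inr (Or.inr (Or.inr (Or.inr (Or.inr (Or.inl ⟨rfl, rfl⟩)))))))))))))) hP hle
      simp only [Nat.cast_ofNat, Int.cast_ofNat] at h
      subst h
      exact mem_zpowers_of_mk0_eq a (cls_P157_63_thirtyone hθ) ha
    · exact absurd hprime (by norm_num)
    · exact absurd hprime (by norm_num)
    · exact absurd hprime (by norm_num)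
    · exact absurd hprime (by norm_num)
    · exact absurd hprime (by norm_num)
    · -- `p = 163` (splits)
      rcases eq_P163_thirtyone hθ h3 hP with h | h | h <;> subst h
      · exact hprinc _ hP0 _ (P163_3_eq_thirtyone hθ)
      · exact mem_zpowers_of_mk0_eq a (cls_P163_38_thirtyone hθ) ha
      · exact mem_zpowers_of_mk0_eq a (cls_P163_153_thirtyone hθ) ha
    · exact absurd hprime (by norm_num)
    · exact absurd hprime (by norm_num)
    · exact absurd hprime (by norm_num)
    · -- `p = 167`
      have h := eq_span_pair_of_unique_root_thirtyone hθ h3 (Or.inr (Or.inr (Or.inr (Or.inr (Or.inr (Or.inr (Or.inr (Or.inr (Or.inr (Or.inr (Or.inr (Or.inr (Or.inr (Or.inr (⟨rfl, rfl⟩))))))))))))))) hP hle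
      simp only [Nat.cast_ofNat, Int.cast_ofNat] at h
      subst h
      exact mem_zpowers_of_mk0_eq a (cls_P167_5_thirtyone hθ) ha
    · exact absurd hprime (by norm_num)
    · exact absurd hprime (by norm_num)
    · exact absurd hprime (by norm_num)
    · exact absurd hprime (by norm_num)
    · exact absurd hprime (by norm_num)
    · exact hprinc P hP0 _ (eq_span_of_inert_thirtyone hθ h3 (by norm_num) hP)
    · exact absurd hprime (by norm_num)
    · exact absurd hprime (by norm_num)
    · exact absurd hprime (by norm_num)
    · exact absurd hprime (by norm_num)
    · exact absurd hprime (by norm_num)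
    · -- `p = 179` (splits)
      rcases eq_P179_thirtyone hθ h3 hP with h | h | h <;> subst h
      · exact hprinc _ hP0 _ (P179_91_eq_thirtyone hθ)
      · exact mem_zpowers_of_mk0_eq a (cls_P179_141_thirtyone hθ) ha
      · exact mem_zpowers_of_mk0_eq a (cls_P179_157_thirtyone hθ) ha
  have hC : C ∈ H := by rw [htop]; exact Subgroup.mem_top C
  obtain ⟨k, rfl⟩ := Subgroup.mem_zpowers_iff.mp hC
  obtain ⟨q, r, hr, rfl⟩ : ∃ q r : ℤ, (r = 0 ∨ r = 1 ∨ r = 2 ∨ r = 3 ∨ r = 4 ∨ r = 5 ∨ r = 6) ∧ k = 7 * q + r :=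
    ⟨k / 7, k % 7, by omega, by omega⟩
  rw [zpow_add, zpow_mul, ham, one_zpow, one_mul]
  rcases hr with rfl | rfl | rfl | rfl | rfl | rfl | rfl
  · exact Or.inl (zpow_zero a)
  · right; left
    rw [show (1 : ℤ) = 1 + 7 * (0) by norm_num, zpow_add, zpow_mul, ham, one_zpow, mul_one,
      zpow_one, ← ha]
  · right; right; left
    rw [show (2 : ℤ) = 2 + 7 * (0) by norm_num, zpow_add, zpow_mul, ham, one_zpow, mul_one,
      ← ha, ← cls_P41_11_thirtyone hθ]
  · right; right; right; left
    rw [show (3 : ℤ) = 3 + 7 * (0) by norm_num, zpow_add, zpow_mul, ham, one_zpow, mul_one,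
      ← ha, ← cls_P23_15_thirtyone hθ]
  · right; right; right; right; left
    rw [show (4 : ℤ) = -3 + 7 * (1) by norm_num, zpow_add, zpow_mul, ham, one_zpow, mul_one,
      ← ha, ← cls_P17_11_thirtyone hθ]
  · right; right; right; right; right; left
    rw [show (5 : ℤ) = -2 + 7 * (1) by norm_num, zpow_add, zpow_mul, ham, one_zpow, mul_one,
      ← ha, ← cls_P7_6_thirtyone hθ]
  · right; right; right; right; right; right
    rw [show (6 : ℤ) = -1 + 7 * (1) by norm_num, zpow_add, zpow_mul, ham, one_zpow, mul_one,
      ← ha, ← cls_P17_9_thirtyone hθ]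


end Field


/-! ### The ideal classes of `ℤ[X]/(f₃₁)` and Gompf's conjecture for the traces `31` and `-26` -/

section Matrices

set_option maxHeartbeats 1000000 in
/-- **The ideal classes of `ℤ[Θ₃₁] = ℤ[X]/(f₃₁)`**: every non-zero ideal is in the class of one of
`⟨Θ - 1, 1⟩`, `⟨Θ - 2, 3⟩`, `⟨Θ - 11, 41⟩`, `⟨Θ - 15, 23⟩`, `⟨Θ - 11, 17⟩`, `⟨Θ - 6, 7⟩`, `⟨Θ - 9, 17⟩` (these representatives cover `C(ℤ[Θ₃₁])`). [cite: KimYamada2023, §6.1 (proof of Thm. B)] -/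
theorem ideal_class_adjoinRoot_thirtyone (J : Ideal (AdjoinRoot (csPoly 31))) (hJ : J ≠ ⊥) :
    ∃ x y : AdjoinRoot (csPoly 31), x ≠ 0 ∧ y ≠ 0 ∧
      (span {x} * J = span {y} * csIdeal 1 1 31 ∨ span {x} * J = span {y} * csIdeal 2 3 31 ∨ span {x} * J = span {y} * csIdeal 11 41 31 ∨ span {x} * J = span {y} * csIdeal 15 23 31 ∨ span {x} * J = span {y} * csIdeal 11 17 31 ∨ span {x} * J = span {y} * csIdeal 6 7 31 ∨ span {x} * J = span {y} * csIdeal 9 17 31) := by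
  classical
  set θ' := AdjoinRoot.root (csPolyQ 31) with hθ'
  have hθ : aeval θ' (csPoly 31) = 0 := aeval_root_csPoly 31
  have h3 : finrank ℚ (CSField 31) = 3 := finrank_CSField 31
  obtain ⟨e, he⟩ := exists_ringEquiv_adjoinRoot_of_sq hθ h3 csDisc_thirtyone_sq
  set I : Ideal (𝓞 (CSField 31)) := J.map e with hI
  have hIJ : I.map (e.symm : 𝓞 (CSField 31) →+* AdjoinRoot (csPoly 31)) = J := by
    rw [hI]
    exact Ideal.map_of_equiv e (I := J)
  have hI0 : I ≠ ⊥ := by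
    intro h0
    apply hJ
    rw [← hIJ, h0, Ideal.map_bot]
  have hImem : I ∈ (Ideal (𝓞 (CSField 31)))⁰ := mem_nonZeroDivisors_iff_ne_zero.mpr hI0
  have hsymm : ∀ x, (e.symm : 𝓞 (CSField 31) →+* AdjoinRoot (csPoly 31)) (e x) = x :=
    fun x => e.symm_apply_apply x
  have hP3_2 : (span {(3 : 𝓞 (CSField 31)), thetaInt hθ - 2}).map
      (e.symm : 𝓞 (CSField 31) →+* AdjoinRoot (csPoly 31)) = csIdeal 2 3 31 := by
    rw [Ideal.map_span, Set.image_insert_eq, Set.image_singleton, map_sub, ← he, hsymm, map_ofNat,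
      map_ofNat, csIdeal, Set.pair_comm]
    simp
  have hP41_11 : (span {(41 : 𝓞 (CSField 31)), thetaInt hθ - 11}).map
      (e.symm : 𝓞 (CSField 31) →+* AdjoinRoot (csPoly 31)) = csIdeal 11 41 31 := by
    rw [Ideal.map_span, Set.image_insert_eq, Set.image_singleton, map_sub, ← he, hsymm, map_ofNat,
      map_ofNat, csIdeal, Set.pair_comm]
    simp
  have hP23_15 : (span {(23 : 𝓞 (CSField 31)), thetaInt hθ - 15}).map
      (e.symm : 𝓞 (CSField 31) →+* AdjoinRoot (csPoly 31)) = csIdeal 15 23 31 := by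
    rw [Ideal.map_span, Set.image_insert_eq, Set.image_singleton, map_sub, ← he, hsymm, map_ofNat,
      map_ofNat, csIdeal, Set.pair_comm]
    simp
  have hP17_11 : (span {(17 : 𝓞 (CSField 31)), thetaInt hθ - 11}).map
      (e.symm : 𝓞 (CSField 31) →+* AdjoinRoot (csPoly 31)) = csIdeal 11 17 31 := by
    rw [Ideal.map_span, Set.image_insert_eq, Set.image_singleton, map_sub, ← he, hsymm, map_ofNat,
      map_ofNat, csIdeal, Set.pair_comm]
    simp
  have hP7_6 : (span {(7 : 𝓞 (CSField 31)), thetaInt hθ - 6}).map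
      (e.symm : 𝓞 (CSField 31) →+* AdjoinRoot (csPoly 31)) = csIdeal 6 7 31 := by
    rw [Ideal.map_span, Set.image_insert_eq, Set.image_singleton, map_sub, ← he, hsymm, map_ofNat,
      map_ofNat, csIdeal, Set.pair_comm]
    simp
  have hP17_9 : (span {(17 : 𝓞 (CSField 31)), thetaInt hθ - 9}).map
      (e.symm : 𝓞 (CSField 31) →+* AdjoinRoot (csPoly 31)) = csIdeal 9 17 31 := by
    rw [Ideal.map_span, Set.image_insert_eq, Set.image_singleton, map_sub, ← he, hsymm, map_ofNat,
      map_ofNat, csIdeal, Set.pair_comm]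
    simp
  have hcase : ∀ (P : Ideal (𝓞 (CSField 31))) (hP0 : P ∈ (Ideal (𝓞 (CSField 31)))⁰)
      (Q : Ideal (AdjoinRoot (csPoly 31))),
      P.map (e.symm : 𝓞 (CSField 31) →+* AdjoinRoot (csPoly 31)) = Q →
      ClassGroup.mk0 ⟨I, hImem⟩ = ClassGroup.mk0 ⟨P, hP0⟩ →
        ∃ x y : AdjoinRoot (csPoly 31), x ≠ 0 ∧ y ≠ 0 ∧ span {x} * J = span {y} * Q := by
    intro P hP0 Q hPQ hcls
    obtain ⟨x, y, hx, hy, hxy⟩ := ClassGroup.mk0_eq_mk0_iff.mp hcls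
    refine ⟨(e.symm : 𝓞 (CSField 31) →+* AdjoinRoot (csPoly 31)) x,
      (e.symm : 𝓞 (CSField 31) →+* AdjoinRoot (csPoly 31)) y,
      (map_ne_zero_iff _ e.symm.injective).mpr hx, (map_ne_zero_iff _ e.symm.injective).mpr hy, ?_⟩
    have h := congrArg (Ideal.map (e.symm : 𝓞 (CSField 31) →+* AdjoinRoot (csPoly 31))) hxy
    simp only [Ideal.map_mul, Ideal.map_span, Set.image_singleton] at h
    rw [hIJ, hPQ] at h
    exact h
  rcases classGroup_mem_thirtyone hθ h3 (ClassGroup.mk0 ⟨I, hImem⟩) with h1 | hcl | hcl | hcl | hcl | hcl | hcl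
  · obtain ⟨z, hz⟩ := ((ClassGroup.mk0_eq_one_iff hImem).mp h1).principal
    have hz' : I = span {z} := by rw [hz, submodule_span_eq]
    have hz0 : z ≠ 0 := by
      rintro rfl
      apply hI0
      rw [hz', Ideal.span_singleton_eq_bot]
    refine ⟨1, (e.symm : 𝓞 (CSField 31) →+* AdjoinRoot (csPoly 31)) z, one_ne_zero,
      (map_ne_zero_iff _ e.symm.injective).mpr hz0, Or.inl ?_⟩
    rw [Ideal.span_singleton_one, Ideal.top_mul, csIdeal_one_one, Ideal.mul_top, ← hIJ, hz',
      Ideal.map_span, Set.image_singleton]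
  · obtain ⟨x, y, hx, hy, h⟩ := hcase _ _ _ hP3_2 hcl
    exact ⟨x, y, hx, hy, Or.inr (Or.inl h)⟩
  · obtain ⟨x, y, hx, hy, h⟩ := hcase _ _ _ hP41_11 hcl
    exact ⟨x, y, hx, hy, Or.inr (Or.inr (Or.inl h))⟩
  · obtain ⟨x, y, hx, hy, h⟩ := hcase _ _ _ hP23_15 hcl
    exact ⟨x, y, hx, hy, Or.inr (Or.inr (Or.inr (Or.inl h)))⟩
  · obtain ⟨x, y, hx, hy, h⟩ := hcase _ _ _ hP17_11 hcl
    exact ⟨x, y, hx, hy, Or.inr (Or.inr (Or.inr (Or.inr (Or.inl h))))⟩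
  · obtain ⟨x, y, hx, hy, h⟩ := hcase _ _ _ hP7_6 hcl
    exact ⟨x, y, hx, hy, Or.inr (Or.inr (Or.inr (Or.inr (Or.inr (Or.inl h)))))⟩
  · obtain ⟨x, y, hx, hy, h⟩ := hcase _ _ _ hP17_9 hcl
    exact ⟨x, y, hx, hy, Or.inr (Or.inr (Or.inr (Or.inr (Or.inr (Or.inr (h))))))⟩

/-- `3 ∣ f₃₁(2)`: `(2, 3, 31) ∈ 𝒞𝒮`. [cite: KimYamada2023, §6.1 (proof of Thm. B)] -/
theorem rep0_dvd_eval_csPoly_thirtyone : (3 : ℤ) ∣ (csPoly 31).eval 2 := by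
  rw [eval_csPoly]; norm_num

/-- `41 ∣ f₃₁(11)`: `(11, 41, 31) ∈ 𝒞𝒮`. [cite: KimYamada2023, §6.1 (proof of Thm. B)] -/
theorem rep1_dvd_eval_csPoly_thirtyone : (41 : ℤ) ∣ (csPoly 31).eval 11 := by
  rw [eval_csPoly]; norm_num

/-- `23 ∣ f₃₁(15)`: `(15, 23, 31) ∈ 𝒞𝒮`. [cite: KimYamada2023, §6.1 (proof of Thm. B)] -/
theorem rep2_dvd_eval_csPoly_thirtyone : (23 : ℤ) ∣ (csPoly 31).eval 15 := by
  rw [eval_csPoly]; norm_num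

/-- `17 ∣ f₃₁(11)`: `(11, 17, 31) ∈ 𝒞𝒮`. [cite: KimYamada2023, §6.1 (proof of Thm. B)] -/
theorem rep3_dvd_eval_csPoly_thirtyone : (17 : ℤ) ∣ (csPoly 31).eval 11 := by
  rw [eval_csPoly]; norm_num

/-- `7 ∣ f₃₁(6)`: `(6, 7, 31) ∈ 𝒞𝒮`. [cite: KimYamada2023, §6.1 (proof of Thm. B)] -/
theorem rep4_dvd_eval_csPoly_thirtyone : (7 : ℤ) ∣ (csPoly 31).eval 6 := by
  rw [eval_csPoly]; norm_num

/-- `17 ∣ f₃₁(9)`: `(9, 17, 31) ∈ 𝒞𝒮`. [cite: KimYamada2023, §6.1 (proof of Thm. B)] -/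
theorem rep5_dvd_eval_csPoly_thirtyone : (17 : ℤ) ∣ (csPoly 31).eval 9 := by
  rw [eval_csPoly]; norm_num

/-- **Every Cappell–Shaneson matrix of trace `31` is similar to one of 7 standard matrices**
(Prop. 2.14). [cite: KimYamada2023, §6.1 (proof of Thm. B) and Prop. 2.14] -/
theorem isConj_standardCSMatrix_of_trace_eq_thirtyone (A : SL(3, ℤ))
    (hdet : ((A : Matrix (Fin 3) (Fin 3) ℤ) - 1).det = 1)
    (htr : Matrix.trace (A : Matrix (Fin 3) (Fin 3) ℤ) = 31) :
    IsConj A (standardCSMatrix 1 1 31 (one_dvd _)) ∨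
      IsConj A (standardCSMatrix 2 3 31 rep0_dvd_eval_csPoly_thirtyone) ∨
      IsConj A (standardCSMatrix 11 41 31 rep1_dvd_eval_csPoly_thirtyone) ∨
      IsConj A (standardCSMatrix 15 23 31 rep2_dvd_eval_csPoly_thirtyone) ∨
      IsConj A (standardCSMatrix 11 17 31 rep3_dvd_eval_csPoly_thirtyone) ∨
      IsConj A (standardCSMatrix 6 7 31 rep4_dvd_eval_csPoly_thirtyone) ∨
      IsConj A (standardCSMatrix 9 17 31 rep5_dvd_eval_csPoly_thirtyone) := by
  have hcover : ∀ J : Ideal (AdjoinRoot (csPoly 31)), J ≠ ⊥ →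
      ∃ (c d : ℤ) (_ : d ∣ (csPoly 31).eval c) (x y : AdjoinRoot (csPoly 31)),
        x ≠ 0 ∧ y ≠ 0 ∧ Ideal.span {x} * J = Ideal.span {y} * csIdeal c d 31 ∧
          ((c = 1 ∧ d = 1) ∨ (c = 2 ∧ d = 3) ∨ (c = 11 ∧ d = 41) ∨ (c = 15 ∧ d = 23) ∨ (c = 11 ∧ d = 17) ∨ (c = 6 ∧ d = 7) ∨ (c = 9 ∧ d = 17)) := by
    intro J hJ
    obtain ⟨x, y, hx, hy, hxy⟩ := ideal_class_adjoinRoot_thirtyone J hJ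
    rcases hxy with h0 | h1 | h2 | h3 | h4 | h5 | h6
    · exact ⟨1, 1, one_dvd _, x, y, hx, hy, h0, Or.inl ⟨rfl, rfl⟩⟩
    · exact ⟨2, 3, rep0_dvd_eval_csPoly_thirtyone, x, y, hx, hy, h1, Or.inr (Or.inl ⟨rfl, rfl⟩)⟩
    · exact ⟨11, 41, rep1_dvd_eval_csPoly_thirtyone, x, y, hx, hy, h2, Or.inr (Or.inr (Or.inl ⟨rfl, rfl⟩))⟩
    · exact ⟨15, 23, rep2_dvd_eval_csPoly_thirtyone, x, y, hx, hy, h3, Or.inr (Or.inr (Or.inr (Or.inl ⟨rfl, rfl⟩)))⟩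
    · exact ⟨11, 17, rep3_dvd_eval_csPoly_thirtyone, x, y, hx, hy, h4, Or.inr (Or.inr (Or.inr (Or.inr (Or.inl ⟨rfl, rfl⟩))))⟩
    · exact ⟨6, 7, rep4_dvd_eval_csPoly_thirtyone, x, y, hx, hy, h5, Or.inr (Or.inr (Or.inr (Or.inr (Or.inr (Or.inl ⟨rfl, rfl⟩)))))⟩
    · exact ⟨9, 17, rep5_dvd_eval_csPoly_thirtyone, x, y, hx, hy, h6, Or.inr (Or.inr (Or.inr (Or.inr (Or.inr (Or.inr (⟨rfl, rfl⟩))))))⟩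
  obtain ⟨c, d, h, hconj, hcd⟩ := exists_isConj_standardCSMatrix_of_cover _ hcover A hdet htr
  rcases hcd with ⟨rfl, rfl⟩ | ⟨rfl, rfl⟩ | ⟨rfl, rfl⟩ | ⟨rfl, rfl⟩ | ⟨rfl, rfl⟩ | ⟨rfl, rfl⟩ | ⟨rfl, rfl⟩
  · exact Or.inl hconj
  · exact Or.inr (Or.inl hconj)
  · exact Or.inr (Or.inr (Or.inl hconj))
  · exact Or.inr (Or.inr (Or.inr (Or.inl hconj)))
  · exact Or.inr (Or.inr (Or.inr (Or.inr (Or.inl hconj))))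
  · exact Or.inr (Or.inr (Or.inr (Or.inr (Or.inr (Or.inl hconj)))))
  · exact Or.inr (Or.inr (Or.inr (Or.inr (Or.inr (Or.inr (hconj))))))

/-- **Kim–Yamada 2023, Theorem B for the trace `31`, PROVED**: the non-trivial classes move by
Gompf moves to the traces `1` (from `(2, 3, 31)`), `-10` (from `(11, 41, 31)`), `8` (from `(15, 23, 31)`), `-3` (from `(11, 17, 31)`), `3` (from `(6, 7, 31)`), `-3` (from `(9, 17, 31)`), where Gompf's conjecture holds. [cite: KimYamada2023, Thm. B, Lemma 6.1 and §6.1] -/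
theorem gompfConjectureForTrace_thirtyone : GompfConjectureForTrace 31 := by
  intro A hdet htr
  rcases isConj_standardCSMatrix_of_trace_eq_thirtyone A hdet htr with h0 | h1 | h2 | h3 | h4 | h5 | h6
  · exact (GompfEquiv.of_isConj h0).trans (gompfEquiv_standardCSMatrix_one_one 29 (one_dvd _))
  · exact (GompfEquiv.of_isConj h1).trans
      (gompfEquiv_standardCSMatrix_akbulutKirbyMatrix_of_modEq
        (gompfConjectureForTrace_of_mem_Icc_neg_seven_twelve (by norm_num)) rep0_dvd_eval_csPoly_thirtyone
        (show (31 : ℤ) ≡ 1 [ZMOD 3] by decide))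
  · exact (GompfEquiv.of_isConj h2).trans
      (gompfEquiv_standardCSMatrix_akbulutKirbyMatrix_of_modEq
        gompfConjectureForTrace_neg_ten rep1_dvd_eval_csPoly_thirtyone
        (show (31 : ℤ) ≡ -10 [ZMOD 41] by decide))
  · exact (GompfEquiv.of_isConj h3).trans
      (gompfEquiv_standardCSMatrix_akbulutKirbyMatrix_of_modEq
        (gompfConjectureForTrace_of_mem_Icc_neg_seven_twelve (by norm_num)) rep2_dvd_eval_csPoly_thirtyone
        (show (31 : ℤ) ≡ 8 [ZMOD 23] by decide))
  · exact (GompfEquiv.of_isConj h4).trans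
      (gompfEquiv_standardCSMatrix_akbulutKirbyMatrix_of_modEq
        (gompfConjectureForTrace_of_mem_Icc_neg_seven_twelve (by norm_num)) rep3_dvd_eval_csPoly_thirtyone
        (show (31 : ℤ) ≡ -3 [ZMOD 17] by decide))
  · exact (GompfEquiv.of_isConj h5).trans
      (gompfEquiv_standardCSMatrix_akbulutKirbyMatrix_of_modEq
        (gompfConjectureForTrace_of_mem_Icc_neg_seven_twelve (by norm_num)) rep4_dvd_eval_csPoly_thirtyone
        (show (31 : ℤ) ≡ 3 [ZMOD 7] by decide))
  · exact (GompfEquiv.of_isConj h6).trans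
      (gompfEquiv_standardCSMatrix_akbulutKirbyMatrix_of_modEq
        (gompfConjectureForTrace_of_mem_Icc_neg_seven_twelve (by norm_num)) rep5_dvd_eval_csPoly_thirtyone
        (show (31 : ℤ) ≡ -3 [ZMOD 17] by decide))

/-- **Theorem B for the trace `-26`** (`= 5 - 31`), by Theorem A. [cite: KimYamada2023, Thm. A and Thm. B] -/
theorem gompfConjectureForTrace_neg_twentysix : GompfConjectureForTrace (-26) := by
  have h := gompfConjectureForTrace_of_five_sub gompfConjectureForTrace_thirtyone
  norm_num at h
  exact h

end Matrices


end Literature.Topology.FourManifolds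

end
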